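import Summits.BirchSwinnertonDyer.BirchSwinnertonDyer.Theorems.KolyvaginRoadThreeMethod2LocalDictionaries
import HarnessLib

/-!
# Route `KolyvaginRoadThree`, deciding crux `ZhangSharpFrameAtThreeHL` (item stmt-BirchSwinnertonDyer-19574):
# the inclusion `H¹_𝓖 ⊆ G(n, ℓ, T)` of the binder `hincl` of `hjump_of_lagrangian`, from per-place dictionaries
# (cell `bsd-stepL`, ACCEL seat `bsd-stepL-koly3b` g5; `--supports stmt-BirchSwinnertonDyer-19574`, helper; part XVI of the
# `KolyvaginRoadThreeZhangSupply*` series)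

HONEST FRAMING. One theorem; 0 definitions, 0 named facts, 0 `sorry`; bookkeeping; closes nothing (T7). PARTITION: O2@3
(B10) × A1 × crux 19574 × the S2-ENGINE's (Supply) binder — proves-glue.

WHAT. `selmerGroup_subset_relaxedGroup`: for a Selmer structure `𝓖` on `E[3]` (Poitou–Tate model) whose local condition
is CONTAINED IN E's genuine Kummer condition `kummerLocalConditionAt` at the infinite places and at the finite `v ≠ λ` off
`T` above no prime of `n`, whose condition above the primes of `n` (off `λ`, `T`) implies the global ORDINARY kernel and
whose condition at the places of `T` implies zhang3-p1's TRANSVERSE kernel (per-place `comap` dictionaries `hGord`, `hGtr`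
— the interface the genuine local ordinary ∕ transverse conditions of the S2-ENGINE package must provide), every class of
`H¹_𝓖(K, E[3])` lies in the relaxed group `G(n, ℓ, T)` of the (Supply) binder: the hypothesis `hincl` of part XIV
`hjump_of_lagrangian`. Kummer dictionary: zhang3-p1's `mem_selmerLocalKer_iff_localization_mem_kummer[_inf]` (p501309).

References: [cite: WZhang2014, §8.1, Lemma 8.2] [cite: MazurRubin2004, Def. 2.1.1].
-/

noncomputable section

open scoped Classical

namespace Summit.BirchSwinnertonDyer.Rank1Residual.X11b.Three.Koly.ZhangSupply

open WeierstrassCurve NumberField IsDedekindDomain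
  Literature.NumberTheory.EllipticCurves Literature.NumberTheory.EllipticCurves.ModularForms
  Literature.NumberTheory.GaloisRepresentations Literature.NumberTheory.GaloisRepresentations.DiscreteGaloisModule
open Summit.BirchSwinnertonDyer.Rank1Residual.X11b.Three.Koly.Method2

variable (W : WeierstrassCurve ℚ) (K : Type) [Field K] [NumberField K] [W.IsGloballyMinimal]
  (ι : K →+* ℂ)

/-- **`H¹_𝓖 ⊆ G(n, ℓ, T)` from per-place dictionaries** (the binder `hincl` of `hjump_of_lagrangian`). See the module
docstring. [cite: WZhang2014, §8.1] [cite: MazurRubin2004, Def. 2.1.1] -/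
theorem selmerGroup_subset_relaxedGroup
    (plK : {ℓ // Zhang2014.IsKolyvaginPrime (W.conductorNorm ℤ) W K 3 ℓ} → HeightOneSpectrum (𝓞 K))
    (n : Finset {q // IsUAdmissiblePrime W K q}) (ℓ : {ℓ // Zhang2014.IsKolyvaginPrime (W.conductorNorm ℤ) W K 3 ℓ})
    (T : Finset {ℓ // Zhang2014.IsKolyvaginPrime (W.conductorNorm ℤ) W K 3 ℓ})
    (𝓖 : SelmerStructure ((W.baseChange K).torsionGaloisModule ((3 ^ 1 : ℕ) : ℤ)))
    (hGinf : ∀ w : InfinitePlace K,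
      𝓖 (Sum.inl w) ≤ (W.baseChange K).kummerLocalConditionAt ((3 ^ 1 : ℕ) : ℤ) w.Completion)
    (hGkum : ∀ v : HeightOneSpectrum (𝓞 K), v ≠ plK ℓ → (∀ ℓ' ∈ T, plK ℓ' ≠ v) →
      (∀ q ∈ n, ((q : ℕ) : 𝓞 K) ∉ v.asIdeal) →
      𝓖 (Sum.inr v) ≤ (W.baseChange K).kummerLocalConditionAt ((3 ^ 1 : ℕ) : ℤ) (v.adicCompletion K))
    (hGord : ∀ v : HeightOneSpectrum (𝓞 K), v ≠ plK ℓ → (∀ ℓ' ∈ T, plK ℓ' ≠ v) → ∀ q ∈ n,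
      ((q : ℕ) : 𝓞 K) ∈ v.asIdeal → ∀ x : V3 W K,
      galoisCohomology.localization ((W.baseChange K).torsionGaloisModule ((3 ^ 1 : ℕ) : ℤ)) (Sum.inr v) 1 x ∈
        𝓖 (Sum.inr v) → x ∈ (W.baseChange K).ordinaryLocalKer (v.adicCompletion K) ((3 ^ 1 : ℕ) : ℤ))
    (hGtr : ∀ ℓ' ∈ T, ∀ x : V3 W K,
      galoisCohomology.localization ((W.baseChange K).torsionGaloisModule ((3 ^ 1 : ℕ) : ℤ)) (Sum.inr (plK ℓ')) 1 x ∈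
        𝓖 (Sum.inr (plK ℓ')) → x ∈ transverseLocalKer W K ι ℓ' (plK ℓ')) :
    ∀ x ∈ 𝓖.selmerGroup,
      (∀ w : InfinitePlace K, x ∈ selmerLocalKer (W.baseChange K) w.Completion ((3 ^ 1 : ℕ) : ℤ)) ∧
        (∀ v : HeightOneSpectrum (𝓞 K), v ≠ plK ℓ → (∀ ℓ' ∈ T, plK ℓ' ≠ v) →
          ((∀ q ∈ n, ((q : ℕ) : 𝓞 K) ∉ v.asIdeal) →
            x ∈ selmerLocalKer (W.baseChange K) (v.adicCompletion K) ((3 ^ 1 : ℕ) : ℤ)) ∧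
          (∀ q ∈ n, ((q : ℕ) : 𝓞 K) ∈ v.asIdeal →
            x ∈ (W.baseChange K).ordinaryLocalKer (v.adicCompletion K) ((3 ^ 1 : ℕ) : ℤ))) ∧
        (∀ ℓ' ∈ T, x ∈ transverseLocalKer W K ι ℓ' (plK ℓ')) := by
  intro x hx
  rw [SelmerStructure.mem_selmerGroup_iff] at hx
  refine ⟨fun w ↦ ?_, fun v hv hvT ↦ ⟨fun hq ↦ ?_, fun q hq hqv ↦ ?_⟩, fun ℓ' hℓ' ↦ ?_⟩
  · exact (mem_selmerLocalKer_iff_localization_mem_kummer_inf W K w x).mpr (hGinf w (hx (Sum.inl w)))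
  · exact (mem_selmerLocalKer_iff_localization_mem_kummer W K v x).mpr (hGkum v hv hvT hq (hx (Sum.inr v)))
  · exact hGord v hv hvT q hq hqv x (hx (Sum.inr v))
  · exact hGtr ℓ' hℓ' x (hx (Sum.inr (plK ℓ')))

end Summit.BirchSwinnertonDyer.Rank1Residual.X11b.Three.Koly.ZhangSupply

end
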